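import Summits.SmoothPoincare4.SmoothPoincare4.Theorems.ConvexBisectionAcyclicBisectionExistsDualHandleBeltMap
import Mathlib.Analysis.SpecialFunctions.SmoothTransition
import Mathlib.Analysis.SpecialFunctions.Trigonometric.Inverse
import HarnessLib

/-!
# Sliding the belt circle inside the handle, I: the isoclinic rotation of `ℝ⁴` and the slide angle
(node T3c-1 `node_belt_isotopic_pushoff` of the sub-goal T3 "the complement piece is the cap with the
DUAL handles" of stub `stub_steinRealisation` (NF6), line `modp-braid-orbits`, crux
`ConvexBisection.AcyclicBisectionExists`, item stmt-SmoothPoincare4-10508; wave 2, worker V6, lead c5)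

In Kosinski's corner-free model of a 4-dimensional 2-handle (`HandleAttachingMaps.lean`: `D⁴ ⊃ T =
{x_λ ≠ 0}`, attaching circle `S = {|x_λ| = 1}`, belt circle `{x_λ = 0, |x_μ| = 1}`, inversion `α`),
the belt circle `B(θ) = (0, 0, θ)` is moved inside the sphere `∂D⁴ ∖ S` by the one-parameter group
of **isoclinic rotations** `R_φ` of `ℝ⁴ = ℝ²_λ × ℝ²_μ` — rotation by `φ` in the plane `(x₀, x₂)`
and by `±φ` in the plane `(x₁, x₃)` — to the circle `R_φ B(θ) = (sin φ · θ^{±}, cos φ · θ)` of the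
torus `{|x_λ| = sin φ}`, which Kosinski's identification `x ∼ h̄ α(x)` glues to the torus of radius
`sin φ` around the attaching circle `K = h̄(S)` in `∂M`: the first leg of the isotopy, in
`∂(M ∪_{h̄} H)`, from the framed belt circle of the handle to a framed longitude of `K`
(Gompf–Stipsicz 1999, §8.2: the belt circle of a 2-handle and the dual 2-handle; needed for the dual
presentation of the complement of a Lefschetz sub-handlebody, Baykur 2006, proof of Thm. 5.1).
This file is the linear algebra and the clock:

* §1 `slideFun b φ` / `slideLin` / `slideEquiv` / **`slideIso b φ : ℝ⁴ ≃ₗᵢ ℝ⁴`** (sign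
  `slideSign b = ∓1`), `norm_slideFun`, `slideFun_neg_slideFun` (`R_{-φ} R_φ = 1`), `slideFun_zero`,
  `lamSq_slideFun`, and the estimate **`lamSq_slideFun_lt_one`**: for `0 ≤ sin φ ≤ 1/2`, `cos φ ≥ 0`
  and `|u_μ|² > 3/4` on the ball, `|R_φ(u)_λ|² < 1` — the rotated thick belt tube stays in the handle
  `D⁴ ∖ S` (Cauchy–Schwarz); `contDiff_slideFun_uncurry` (jointly smooth in `(φ, u)`);
* §2 the slide angle **`slideAngle r t = arcsin (radClamp r) · χ(t)`** (`χ` = `Real.smoothTransition`,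
  `radClamp r ∈ [0, 1/2]`): in `[0, π/6]`, `sin ∈ [0, 1/2]`, `cos > 0`, `= 0` for `t ≤ 0`,
  `sin = r`, `cos = √(1 - r²)` at `t = 1` (`0 ≤ r ≤ 1/2`), smooth in `t`;
* §3 registered helper `helper_belt_slideRotation`.

Everything is proved; no named facts.  Sequels: `…BeltSlideTube.lean`, `…BeltSlideLongitude.lean`,
`…BeltSlideFraming.lean`.

## References
* A. A. Kosinski, *Differential Manifolds*, Academic Press (1993), VI §6, (6.1). [Kosinski1993]
* J. Milnor, *Lectures on the h-cobordism theorem* (1965), §3 (dual handles). [MilnorHCobordism1965]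
* R. C. Kirby, *The Topology of 4-Manifolds*, LNM 1374 (1989), Ch. I §2 (framings). [Kirby1989]
* R. E. Gompf, A. I. Stipsicz, *4-Manifolds and Kirby Calculus* (1999), §8.2. [GompfStipsicz1999]
-/

noncomputable section

-- the prescribed namespace `Summit.<P>.<Sub>.…` duplicates `SmoothPoincare4` (P = Sub)
set_option linter.dupNamespace false

open scoped Manifold ContDiff Topology
open Set Function Metric Real

namespace Summit.SmoothPoincare4.SmoothPoincare4.Theorems.AcyclicBisectionExists.ModpBraidOrbits

open Literature.Topology.FourManifolds Literature.Topology.FourManifolds.HandleAttachingMap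

/-! ### §1 The isoclinic rotations `R_φ` of `ℝ⁴` -/

/-- The sign `∓1` of the direction flag: `false ↦ 1` (slide towards the longitude `x_λ ∥ x_μ`),
`true ↦ -1` (towards `x_λ ∥ x̄_μ`). [folklore] -/
def slideSign (b : Bool) : ℝ := if b then -1 else 1

/-- `slideSign b * slideSign b = 1`. [folklore] -/
@[simp] theorem slideSign_mul_self (b : Bool) : slideSign b * slideSign b = 1 := by
  cases b <;> simp [slideSign]

/-- `slideSign b ^ 2 = 1`. [folklore] -/
@[simp] theorem slideSign_sq (b : Bool) : slideSign b ^ 2 = 1 := by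
  rw [sq, slideSign_mul_self]

/-- **The isoclinic rotation `R_φ` of `ℝ⁴ = ℝ²_λ × ℝ²_μ` by the angle `φ`** in the planes
`(x₀, x₂)` and `(x₁, ± x₃)` simultaneously (sign `slideSign b`), as a function. [folklore] -/
def slideFun (b : Bool) (φ : ℝ) (u : EuclideanSpace ℝ (Fin 4)) : EuclideanSpace ℝ (Fin 4) :=
  WithLp.toLp 2 ![cos φ * u 0 + sin φ * u 2, cos φ * u 1 + slideSign b * sin φ * u 3,
    -sin φ * u 0 + cos φ * u 2, -(slideSign b * sin φ) * u 1 + cos φ * u 3]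

/-- Coordinate `0` of `R_φ u`. [folklore] -/
@[simp] theorem slideFun_apply_zero (b : Bool) (φ : ℝ) (u : EuclideanSpace ℝ (Fin 4)) :
    slideFun b φ u 0 = cos φ * u 0 + sin φ * u 2 := rfl
/-- Coordinate `1` of `R_φ u`. [folklore] -/
@[simp] theorem slideFun_apply_one (b : Bool) (φ : ℝ) (u : EuclideanSpace ℝ (Fin 4)) :
    slideFun b φ u 1 = cos φ * u 1 + slideSign b * sin φ * u 3 := rfl
/-- Coordinate `2` of `R_φ u`. [folklore] -/
@[simp] theorem slideFun_apply_two (b : Bool) (φ : ℝ) (u : EuclideanSpace ℝ (Fin 4)) :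
    slideFun b φ u 2 = -sin φ * u 0 + cos φ * u 2 := rfl
/-- Coordinate `3` of `R_φ u`. [folklore] -/
@[simp] theorem slideFun_apply_three (b : Bool) (φ : ℝ) (u : EuclideanSpace ℝ (Fin 4)) :
    slideFun b φ u 3 = -(slideSign b * sin φ) * u 1 + cos φ * u 3 := rfl

/-- `R_φ` as a linear map. [folklore] -/
def slideLin (b : Bool) (φ : ℝ) : EuclideanSpace ℝ (Fin 4) →ₗ[ℝ] EuclideanSpace ℝ (Fin 4) where
  toFun := slideFun b φ
  map_add' u v := by
    ext i; fin_cases i <;> simp <;> ring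
  map_smul' c u := by
    ext i; fin_cases i <;> simp <;> ring

/-- `R_{-φ} ∘ R_φ = id`. [folklore] -/
theorem slideFun_neg_slideFun (b : Bool) (φ : ℝ) (u : EuclideanSpace ℝ (Fin 4)) :
    slideFun b (-φ) (slideFun b φ u) = u := by
  have h := sin_sq_add_cos_sq φ
  ext i
  fin_cases i <;> cases b <;> simp [cos_neg, sin_neg, slideSign] <;>
    first
    | linear_combination (u 0) * h
    | linear_combination (u 1) * h
    | linear_combination (u 2) * h
    | linear_combination (u 3) * h

/-- `R_φ` as a linear equivalence with inverse `R_{-φ}`. [folklore] -/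
def slideEquiv (b : Bool) (φ : ℝ) : EuclideanSpace ℝ (Fin 4) ≃ₗ[ℝ] EuclideanSpace ℝ (Fin 4) :=
  { slideLin b φ with
    invFun := slideFun b (-φ)
    left_inv := fun u => slideFun_neg_slideFun b φ u
    right_inv := fun u => by
      have h := slideFun_neg_slideFun b (-φ) u
      rwa [neg_neg] at h }

/-- `‖R_φ u‖ = ‖u‖`. [folklore] -/
theorem norm_slideFun (b : Bool) (φ : ℝ) (u : EuclideanSpace ℝ (Fin 4)) : ‖slideFun b φ u‖ = ‖u‖ := by
  have h := sin_sq_add_cos_sq φ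
  have hs := slideSign_sq b
  have e : ‖slideFun b φ u‖ ^ 2 = ‖u‖ ^ 2 := by
    rw [EuclideanSpace.norm_sq_eq, EuclideanSpace.norm_sq_eq, Fin.sum_univ_four, Fin.sum_univ_four]
    simp only [Real.norm_eq_abs, sq_abs, slideFun_apply_zero, slideFun_apply_one, slideFun_apply_two,
      slideFun_apply_three]
    linear_combination (u 0 ^ 2 + u 1 ^ 2 + u 2 ^ 2 + u 3 ^ 2) * h +
      (sin φ ^ 2 * (u 1 ^ 2 + u 3 ^ 2)) * hs
  nlinarith [norm_nonneg (slideFun b φ u), norm_nonneg u]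

/-- **The isoclinic rotation `R_φ` as a linear isometry of `ℝ⁴`.** [folklore] -/
def slideIso (b : Bool) (φ : ℝ) : EuclideanSpace ℝ (Fin 4) ≃ₗᵢ[ℝ] EuclideanSpace ℝ (Fin 4) :=
  { slideEquiv b φ with norm_map' := norm_slideFun b φ }

/-- `slideIso` acts as `slideFun`. [folklore] -/
@[simp] theorem slideIso_apply (b : Bool) (φ : ℝ) (u : EuclideanSpace ℝ (Fin 4)) :
    slideIso b φ u = slideFun b φ u := rfl

/-- `R_0 = id`. [folklore] -/
theorem slideFun_zero (b : Bool) (u : EuclideanSpace ℝ (Fin 4)) : slideFun b 0 u = u := by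
  ext i; fin_cases i <;> simp

/-- `|R_φ(u)_λ|²`. [folklore] -/
theorem lamSq_slideFun (b : Bool) (φ : ℝ) (u : EuclideanSpace ℝ (Fin 4)) :
    lamSq 2 (slideFun b φ u) =
      (cos φ * u 0 + sin φ * u 2) ^ 2 + (cos φ * u 1 + slideSign b * sin φ * u 3) ^ 2 := by
  rw [lamSq_two_fin_four]; rfl

/-- **The rotation keeps thick belt points inside the handle**: if `|u_μ|² > 3/4` (so
`|u_λ|² < 1/4` on the ball) and `0 ≤ sin φ ≤ 1/2`, `0 ≤ cos φ`, then `|R_φ(u)_λ|² < 1`.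
[folklore] -/
theorem lamSq_slideFun_lt_one (b : Bool) {φ : ℝ} (h0 : 0 ≤ sin φ) (h1 : sin φ ≤ 1 / 2)
    (hc : 0 ≤ cos φ) {u : EuclideanSpace ℝ (Fin 4)} (hu : ‖u‖ ≤ 1) (hmu : 3 / 4 < muSq 2 u) :
    lamSq 2 (slideFun b φ u) < 1 := by
  have hsum := lamSq_add_muSq 2 u
  have hu1 : ‖u‖ ^ 2 ≤ 1 := by nlinarith [norm_nonneg u]
  have hlam : lamSq 2 u < 1 / 4 := by linarith
  rw [lamSq_two_fin_four] at hlam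
  rw [muSq_two_fin_four] at hmu
  have hmu1 : u 2 ^ 2 + u 3 ^ 2 ≤ 1 := by
    have := lamSq_add_muSq 2 u
    rw [lamSq_two_fin_four, muSq_two_fin_four] at this
    nlinarith [sq_nonneg (u 0), sq_nonneg (u 1)]
  have hcs := sin_sq_add_cos_sq φ
  have hs := slideSign_sq b
  rw [lamSq_slideFun]
  -- absorb the sign into the last coordinate
  set v3 := slideSign b * u 3 with hv3
  have hv3sq : v3 ^ 2 = u 3 ^ 2 := by rw [hv3, mul_pow, hs, one_mul]
  have e1 : cos φ * u 1 + slideSign b * sin φ * u 3 = cos φ * u 1 + sin φ * v3 := by rw [hv3]; ring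
  rw [e1]
  -- Cauchy–Schwarz: (c a + s b)² + (c a' + s b')² ≤ (c √A + s √B)² with A = a²+a'², B = b²+b'²
  set A := u 0 ^ 2 + u 1 ^ 2 with hA
  set B := u 2 ^ 2 + u 3 ^ 2 with hB
  have hB' : B = u 2 ^ 2 + v3 ^ 2 := by rw [hB, hv3sq]
  have hA0 : 0 ≤ A := by positivity
  have hB0 : 0 ≤ B := by positivity
  have key : (cos φ * u 0 + sin φ * u 2) ^ 2 + (cos φ * u 1 + sin φ * v3) ^ 2 ≤
      (cos φ * Real.sqrt A + sin φ * Real.sqrt B) ^ 2 := by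
    have hsA := Real.sq_sqrt hA0
    have hsB := Real.sq_sqrt hB0
    have hAB : u 0 * u 2 + u 1 * v3 ≤ Real.sqrt A * Real.sqrt B := by
      have h2 : (u 0 * u 2 + u 1 * v3) ^ 2 ≤ A * B := by
        have : A * B - (u 0 * u 2 + u 1 * v3) ^ 2 = (u 0 * v3 - u 1 * u 2) ^ 2 := by
          rw [hA, hB']; ring
        nlinarith [sq_nonneg (u 0 * v3 - u 1 * u 2)]
      have h3 : |u 0 * u 2 + u 1 * v3| ≤ Real.sqrt A * Real.sqrt B := by
        rw [← Real.sqrt_mul hA0, ← Real.sqrt_sq_eq_abs]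
        exact Real.sqrt_le_sqrt h2
      exact le_trans (le_abs_self _) h3
    have hcs0 : 0 ≤ cos φ * sin φ := mul_nonneg hc h0
    have expand : (cos φ * Real.sqrt A + sin φ * Real.sqrt B) ^ 2 -
        ((cos φ * u 0 + sin φ * u 2) ^ 2 + (cos φ * u 1 + sin φ * v3) ^ 2) =
        2 * (cos φ * sin φ) * (Real.sqrt A * Real.sqrt B - (u 0 * u 2 + u 1 * v3)) := by
      have eA : Real.sqrt A ^ 2 = u 0 ^ 2 + u 1 ^ 2 := by rw [hsA]
      have eB : Real.sqrt B ^ 2 = u 2 ^ 2 + v3 ^ 2 := by rw [hsB, hB']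
      linear_combination (cos φ ^ 2) * eA + (sin φ ^ 2) * eB
    nlinarith [mul_nonneg hcs0 (sub_nonneg.2 hAB)]
  have hsqA : Real.sqrt A < 1 / 2 := by
    rw [show (1 / 2 : ℝ) = Real.sqrt (1 / 4) by
      rw [show (1 / 4 : ℝ) = (1 / 2) ^ 2 by norm_num, Real.sqrt_sq (by norm_num)]]
    exact Real.sqrt_lt_sqrt hA0 hlam
  have hsqB : Real.sqrt B ≤ 1 := by
    rw [show (1 : ℝ) = Real.sqrt 1 by simp]
    exact Real.sqrt_le_sqrt hmu1
  have hbound : cos φ * Real.sqrt A + sin φ * Real.sqrt B < 1 := by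
    have hc1 : cos φ ≤ 1 := cos_le_one φ
    have hsq0 : 0 ≤ Real.sqrt A := Real.sqrt_nonneg A
    by_cases hc0 : cos φ = 0
    · have : sin φ * Real.sqrt B ≤ 1 / 2 * 1 :=
        mul_le_mul h1 hsqB (Real.sqrt_nonneg B) (by norm_num)
      rw [hc0]; linarith
    · have hcpos : 0 < cos φ := lt_of_le_of_ne hc (Ne.symm hc0)
      have e1 : cos φ * Real.sqrt A < cos φ * (1 / 2) := mul_lt_mul_of_pos_left hsqA hcpos
      have e2 : sin φ * Real.sqrt B ≤ 1 / 2 * 1 :=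
        mul_le_mul h1 hsqB (Real.sqrt_nonneg B) (by norm_num)
      nlinarith
  have hpos : 0 ≤ cos φ * Real.sqrt A + sin φ * Real.sqrt B := by positivity
  calc _ ≤ (cos φ * Real.sqrt A + sin φ * Real.sqrt B) ^ 2 := key
    _ < 1 := by nlinarith


/-- `R_φ` is jointly smooth in the angle and the vector. [folklore] -/
theorem contDiff_slideFun_uncurry (b : Bool) :
    ContDiff ℝ ∞ fun p : ℝ × EuclideanSpace ℝ (Fin 4) => slideFun b p.1 p.2 := by
  have hc : ContDiff ℝ ∞ fun p : ℝ × EuclideanSpace ℝ (Fin 4) => cos p.1 := Real.contDiff_cos.comp contDiff_fst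
  have hs : ContDiff ℝ ∞ fun p : ℝ × EuclideanSpace ℝ (Fin 4) => sin p.1 := Real.contDiff_sin.comp contDiff_fst
  have hx : ∀ i : Fin 4, ContDiff ℝ ∞ fun p : ℝ × EuclideanSpace ℝ (Fin 4) => p.2 i := fun i =>
    (contDiff_piLp_apply (𝕜 := ℝ) (n := ∞) 2 (E := fun _ : Fin 4 => ℝ) (i := i)).comp contDiff_snd
  refine contDiff_piLp' 2 fun i => ?_
  fin_cases i
  · exact (hc.mul (hx 0)).add (hs.mul (hx 2))
  · exact (hc.mul (hx 1)).add ((contDiff_const.mul hs).mul (hx 3))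
  · exact (hs.neg.mul (hx 0)).add (hc.mul (hx 2))
  · exact ((contDiff_const.mul hs).neg.mul (hx 1)).add (hc.mul (hx 3))

/-! ### §2 The slide angle `φ_r(t) = arcsin r · χ(t)` -/

/-- The radius clamped to `[0, 1/2]`. [folklore] -/
def radClamp (r : ℝ) : ℝ := max 0 (min r (1 / 2))

/-- `0 ≤ radClamp r`. [folklore] -/
theorem radClamp_nonneg (r : ℝ) : 0 ≤ radClamp r := le_max_left _ _

/-- `radClamp r ≤ 1/2`. [folklore] -/
theorem radClamp_le (r : ℝ) : radClamp r ≤ 1 / 2 :=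
  max_le (by norm_num) (min_le_right _ _)

/-- On `[0, 1/2]` the clamp is the identity. [folklore] -/
theorem radClamp_of_mem {r : ℝ} (h0 : 0 ≤ r) (h1 : r ≤ 1 / 2) : radClamp r = r := by
  rw [radClamp, min_eq_left h1, max_eq_right h0]

/-- **The slide angle** `φ_r(t) = arcsin (radClamp r) · χ(t)`, `χ` Mathlib's smooth transition
(`0` for `t ≤ 0`, `1` for `t ≥ 1`): from `0` to `arcsin r`, constant outside `[0, 1]`. [folklore] -/
def slideAngle (r t : ℝ) : ℝ := Real.arcsin (radClamp r) * Real.smoothTransition t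

/-- The maximal angle `arcsin (radClamp r)` lies in `[0, π/6]`. [folklore] -/
theorem arcsin_radClamp_mem (r : ℝ) : Real.arcsin (radClamp r) ∈ Icc 0 (π / 6) := by
  refine ⟨Real.arcsin_nonneg.2 (radClamp_nonneg r), ?_⟩
  have h : Real.arcsin (radClamp r) ≤ Real.arcsin (1 / 2) := Real.arcsin_le_arcsin (radClamp_le r)
  have e : Real.arcsin (1 / 2 : ℝ) = π / 6 := by
    rw [show (1 / 2 : ℝ) = sin (π / 6) by rw [Real.sin_pi_div_six]]
    exact Real.arcsin_sin (by linarith [Real.pi_pos]) (by linarith [Real.pi_pos])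
  rwa [e] at h

/-- `0 ≤ φ_r(t) ≤ arcsin (radClamp r)`. [folklore] -/
theorem slideAngle_mem (r t : ℝ) : slideAngle r t ∈ Icc 0 (Real.arcsin (radClamp r)) := by
  have h0 := (arcsin_radClamp_mem r).1
  refine ⟨mul_nonneg h0 (Real.smoothTransition.nonneg t), ?_⟩
  exact mul_le_of_le_one_right h0 (Real.smoothTransition.le_one t)

/-- `φ_r(t) ∈ [0, π/6]`. [folklore] -/
theorem slideAngle_mem_Icc (r t : ℝ) : slideAngle r t ∈ Icc 0 (π / 6) :=
  ⟨(slideAngle_mem r t).1, (slideAngle_mem r t).2.trans (arcsin_radClamp_mem r).2⟩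

/-- `0 ≤ sin φ_r(t)`. [folklore] -/
theorem sin_slideAngle_nonneg (r t : ℝ) : 0 ≤ sin (slideAngle r t) :=
  Real.sin_nonneg_of_nonneg_of_le_pi (slideAngle_mem_Icc r t).1
    ((slideAngle_mem_Icc r t).2.trans (by linarith [Real.pi_pos]))

/-- `sin φ_r(t) ≤ radClamp r ≤ 1/2`. [folklore] -/
theorem sin_slideAngle_le (r t : ℝ) : sin (slideAngle r t) ≤ radClamp r := by
  have h := Real.sin_le_sin_of_le_of_le_pi_div_two (x := slideAngle r t) (y := Real.arcsin (radClamp r))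
    (by linarith [(slideAngle_mem r t).1, Real.pi_pos]) (Real.arcsin_le_pi_div_two _) (slideAngle_mem r t).2
  rwa [Real.sin_arcsin (by linarith [radClamp_nonneg r]) (by linarith [radClamp_le r])] at h

/-- `sin φ_r(t) ≤ 1/2`. [folklore] -/
theorem sin_slideAngle_le_half (r t : ℝ) : sin (slideAngle r t) ≤ 1 / 2 :=
  (sin_slideAngle_le r t).trans (radClamp_le r)

/-- `0 < cos φ_r(t)`. [folklore] -/
theorem cos_slideAngle_pos (r t : ℝ) : 0 < cos (slideAngle r t) :=
  Real.cos_pos_of_mem_Ioo ⟨by linarith [(slideAngle_mem_Icc r t).1, Real.pi_pos],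
    by linarith [(slideAngle_mem_Icc r t).2, Real.pi_pos]⟩

/-- `φ_r(t) = 0` for `t ≤ 0`. [folklore] -/
theorem slideAngle_of_nonpos (r : ℝ) {t : ℝ} (ht : t ≤ 0) : slideAngle r t = 0 := by
  rw [slideAngle, Real.smoothTransition.zero_of_nonpos ht, mul_zero]

/-- `φ_r(t) = arcsin r` for `t ≥ 1` and `r ∈ [0, 1/2]`. [folklore] -/
theorem slideAngle_of_one_le {r : ℝ} (h0 : 0 ≤ r) (h1 : r ≤ 1 / 2) {t : ℝ} (ht : 1 ≤ t) :
    slideAngle r t = Real.arcsin r := by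
  rw [slideAngle, Real.smoothTransition.one_of_one_le ht, mul_one, radClamp_of_mem h0 h1]

/-- At the end, `sin φ_r(1) = r`. [folklore] -/
theorem sin_slideAngle_one {r : ℝ} (h0 : 0 ≤ r) (h1 : r ≤ 1 / 2) : sin (slideAngle r 1) = r := by
  rw [slideAngle_of_one_le h0 h1 le_rfl, Real.sin_arcsin (by linarith) (by linarith)]

/-- At the end, `cos φ_r(1) = √(1 - r²)`. [folklore] -/
theorem cos_slideAngle_one {r : ℝ} (h0 : 0 ≤ r) (h1 : r ≤ 1 / 2) :
    cos (slideAngle r 1) = Real.sqrt (1 - r ^ 2) := by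
  rw [slideAngle_of_one_le h0 h1 le_rfl, Real.cos_arcsin]

/-- The slide angle is a smooth function of time. [folklore] -/
theorem contDiff_slideAngle (r : ℝ) : ContDiff ℝ ∞ (slideAngle r) :=
  contDiff_const.mul Real.smoothTransition.contDiff


/-! ### §3 Registered helper -/

/-- **Registered helper `helper_belt_slideRotation` (stage 1a of node T3c-1 of NF6
`stub_steinRealisation`, wave 2, lead c5): the isoclinic rotations of `ℝ⁴ = ℝ²_λ × ℝ²_μ`.**  For a
direction flag `b` and an angle `φ` there is a linear isometry `R_φ` of `ℝ⁴` rotating the planes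
`(x₀, x₂)` by `φ` and `(x₁, x₃)` by `∓φ`, and for `0 ≤ sin φ ≤ 1/2`, `0 ≤ cos φ` it maps the thick
belt tube `{‖u‖ ≤ 1, |u_μ|² > 3/4}` into the handle `{|x_λ|² < 1}`. [cite: Kosinski1993, VI §6] -/
theorem helper_belt_slideRotation :
    ∀ (b : Bool) (φ : ℝ), ∃ A : EuclideanSpace ℝ (Fin 4) ≃ₗᵢ[ℝ] EuclideanSpace ℝ (Fin 4),
      (∀ u : EuclideanSpace ℝ (Fin 4), A u = WithLp.toLp 2
        ![Real.cos φ * u 0 + Real.sin φ * u 2, Real.cos φ * u 1 + (if b then -1 else 1) * Real.sin φ * u 3,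
          -Real.sin φ * u 0 + Real.cos φ * u 2, -((if b then -1 else 1) * Real.sin φ) * u 1 + Real.cos φ * u 3]) ∧
      (0 ≤ Real.sin φ → Real.sin φ ≤ 1 / 2 → 0 ≤ Real.cos φ → ∀ u : EuclideanSpace ℝ (Fin 4), ‖u‖ ≤ 1 →
        3 / 4 < Literature.Topology.FourManifolds.muSq 2 u →
          Literature.Topology.FourManifolds.lamSq 2 (A u) < 1) :=
  fun b φ => ⟨slideIso b φ, fun _ => rfl, fun h0 h1 hc _ hu hmu => lamSq_slideFun_lt_one b h0 h1 hc hu hmu⟩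

end Summit.SmoothPoincare4.SmoothPoincare4.Theorems.AcyclicBisectionExists.ModpBraidOrbits

end
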